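import Literature.AnabelianGeometry.EtaleTheta.Discharge.Sec5MonoThetaUniversalClosureRefuted

/-!
# [EtTh] §5 pp.330–331 (PDF pp.104–105): the universal closure of the bundle `ThetaFrobenioid.Facts` is FALSE
# (FACT-LIST F-2494 — R5 «named instances only»; instance forms of record cited BY NAME)

Mochizuki, *The étale theta function and its Frobenioid-theoretic manifestations*, Publ. RIMS **45** (2009), §5
pp.330–331 (PDF pp.104–105) [cite: MochizukiEtTh2009, §5 p.330 (PDF p.104)].  Cell abc-iut, D-0079 L-F sub-cell [EtTh]
(row F-2494 was «LABEL-OPEN, no name-matched kernel event» in plan/LF-KERNEL-STATUS.tsv of 14:13Z), seat abc-iut-f-112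
(gen 4).  PROOF-ONLY companion of abc-iut-L2-t4's `FrobenioidMonoTheta.lean` (`ThetaFrobenioid.Facts`, the bundle of the
§5 named inputs: defining relations of `s^⊓-gp_N`, `s^⊔-gp_N`, section property of `s^trv_N`, Prop. 4.3 (iii), Aut-ampleness
of `B_N`, the arithmetic step of Lemma 5.8, total epimorphicity at `s^⊓_N`, `s^⊔_N`); no new `Prop` fact, no definition, no
edit of a statement file.

RESULT `ThetaFrobenioid.not_forall_facts`: over the DATA-ONLY §5 interface `ThetaFrobenioid C D` the universal closure
`∀ 𝔉, 𝔉.Facts` fails — at this seat's toy §5 datum `MonoThetaToy.toyTheta' PUnit ⋆` (base CONSTANT to the one-object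
category of `ℤ/2`, so `Aut_D(B_N^bs) = ℤ/2` while `Aut_C(B_N) → Aut_D(B_N^bs)` is trivial) the field `autAmpleBN`
("`B_N` is Aut-ample", p.330 (PDF p.104)) is false (`MonoThetaToy.not_autAmpleBN_toy`, FACT-LIST F-0737's witness, p430173).

INSTANCE FORMS OF RECORD (not restated here): `ThetaFrobenioid.Facts.of` / `Facts.of_totallyEpi`
(`Discharge/Sec5AutAmple.lean`: the bundle from its five printed inputs, Aut-ampleness DERIVED) and, at the GENUINE data,
`ThetaFrobenioidTower.facts_levelData` / `facts_atLevel` (`Discharge/Sec5TowerOfBiKummerFamilyFacts.lean`: the bundle at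
every level of the assembled tower of bi-Kummer `N`-th roots from `ConstantsActByCyclotome` alone).
HONEST FRAMING: a toy datum says nothing about the tempered Frobenioid of `Ÿ`; a FACT row is an assumption label; typed ≠ proved;
no side taken on [IUTchIII] Cor. 3.12.
-/

namespace Literature.AnabelianGeometry.EtaleTheta

namespace ThetaFrobenioid

open CategoryTheory

/-- At the toy §5 datum `MonoThetaToy.toyTheta' J j` the bundle `Facts` fails: its field `autAmpleBN` is
`MonoThetaToy.not_autAmpleBN_toy`.  [cite: MochizukiEtTh2009, §5 p.330 (PDF p.104)] -/
theorem MonoThetaToy.not_facts_toy (J : Type) (j : J) : ¬ (MonoThetaToy.toyTheta' J j).Facts :=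
  fun H => MonoThetaToy.not_autAmpleBN_toy J j H.autAmpleBN

/-- **F-2494: the universal closure of the §5 bundle `ThetaFrobenioid.Facts` is FALSE** (R5: named §5 data only —
instance forms `Facts.of_totallyEpi`, `ThetaFrobenioidTower.facts_levelData` / `facts_atLevel`).
[cite: MochizukiEtTh2009, §5 p.330–331 (PDF pp.104–105)] -/
theorem not_forall_facts :
    ¬ ∀ (C : Type) [Category.{0} C] (D : Type) [Category.{0} D] (𝔉 : ThetaFrobenioid.{0} C D), 𝔉.Facts :=
  fun h => MonoThetaToy.not_facts_toy PUnit PUnit.unit (h _ _ (MonoThetaToy.toyTheta' PUnit PUnit.unit))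

/-- The same failure read through the bundle's one redundant field: even WITHOUT `autAmpleBN` as a field the closure
would fail, since `Facts` implies `SgpCapSection` (`Facts.sgpCapSection`), false at the toy (F-0738's witness
`MonoThetaToy.not_sgpCapSection_toy`).  [cite: MochizukiEtTh2009, §5 p.331 (PDF p.105)] -/
theorem MonoThetaToy.not_facts_toy' (J : Type) (j : J) : ¬ (MonoThetaToy.toyTheta' J j).Facts :=
  fun H => MonoThetaToy.not_sgpCapSection_toy J j H.sgpCapSection

end ThetaFrobenioid

end Literature.AnabelianGeometry.EtaleTheta
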